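import Summits.NavierStokesRegularity.NavierStokesRegularity.Theses.AxisymmetricExtremality
import Literature.Analysis.FluidPDE.CKNEpsilonRegularityHolds
import HarnessLib

/-!
# Route AxisymmetricExtremality — crux `MinimalDatumPFold` (stmt-NavierStokesRegularity-15452), stub `stub_uniformRegularity`

Registered stub of the line `Sketch` (`Cruxes/MinimalDatumPFold/Lines/Sketch.lean`, lead c2):
the QUANTITATIVE form of Rusin–Šverák 2011, Lemma 2.1 (= Jia–Šverák 2013, Lemma 6). In the
situation of Rusin–Šverák's Prop. 2.2 (`RusinSverak2011.CompactnessSituation O useq pseq u p`),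
near a regular point `z₀ ∈ O` of the limit `u` the approximants `u^k` are uniformly essentially
bounded on a fixed centred cylinder `Q*_ρ(z₀)`, eventually in `k`.
Target tree file:
`Summits/NavierStokesRegularity/NavierStokesRegularity/Theorems/AxisymmetricExtremalityMinimalDatumPFoldUniformRegularity.lean`.

Proof summary (two adaptations of accepted tree proofs):

* `uniformRegularity_oneScale_quantitative` — the unforced one-scale ε-regularity criterion in
  quantitative form: the proof of `RRS2016.theorem15_3.unforced_oneScale`
  (`RusinSverakSingularityStabilityEpsilon.lean`) fed with the proved `RRS2016.theorem15_3_holds`,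
  keeping the a.e. bound `‖u‖ ≤ c_M ε₀^{1/3} / r` on `Q_{r/2}(z)` (any `0 < ε₀ ≤ ε₁`) instead of
  concluding `u ∈ L^∞`;
* `stub_uniformRegularity` — the proof of `rusin_sverak_stability_of_singularities_of_unforced`
  (`RusinSverakSingularityStability.lean`) verbatim up to the choice of the witness `k`: the radii
  `r₁, r₀`, the step count `J`, the last scale `s = θᴶ r₀`, the shift `h = s²/8`, the centre
  `z' = (t₀ + h, x₀)` and the sub-cylinder `Q*_{√h}(z₀) ⊆ Q_{s/2}(z')` are chosen BEFORE `k`; then,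
  eventually in `k` (strong `L³` convergence on the box `K`), `C_k(s) + D_k(s) ≤ ε₁` at `z'`
  (pressure decay estimate iterated `J` times, uniform `L^{3/2}` pressure bound), and the
  quantitative criterion bounds `‖u^k‖ ≤ c_M ε₁^{1/3} / s` a.e. on `Q_{s/2}(z') ⊇ Q*_{√h}(z₀)`.
-/

set_option linter.dupNamespace false

noncomputable section

open MeasureTheory TopologicalSpace Set Function Filter Topology Metric
open scoped ENNReal NNReal

namespace Summit.NavierStokesRegularity.NavierStokesRegularity.Theorems

open Literature.Analysis.FluidPDE

/-- **The unforced one-scale ε-regularity criterion, quantitative form** (Robinson–Rodrigo–Sadowski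
2016, Thm. 15.4 with the bound of Thm. 15.3 kept: there are absolute `ε₁, c_M > 0` such that for a
suitable weak solution `(u, p)` of the unforced unit-viscosity equations on `O`, a cylinder
`Q̄_r(z) ⊆ O` and `0 < ε₀ ≤ ε₁` with `C(r; z) + D(r; z) ≤ ε₀`, `‖u‖ ≤ c_M ε₀^{1/3} / r` a.e. on
`Q_{r/2}(z)`). Proof: that of `RRS2016.theorem15_3.unforced_oneScale` — restrict to `Q_r(z)`,
rescale onto `Q_1(0, 0)` (`IsLRSuitableWeakSolutionOn.nsRescale`), pass to a suitable pair
(`IsLRSuitableWeakSolutionOn.isSuitablePair`), read (15.18) for the rescaled pair as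
`C(r; z) + D(r; z) ≤ ε₀`, apply `RRS2016.theorem15_3_holds` at level `ε₀`, pull the bound back.
[cite: RobinsonRodrigoSadowski2016, Thm. 15.3 p. 220 and Thm. 15.4 p. 226] -/
theorem uniformRegularity_oneScale_quantitative :
    ∃ ε₁ cM : ℝ, 0 < ε₁ ∧ 0 < cM ∧ ∀ (O : Opens (ℝ × EuclideanSpace ℝ (Fin 3)))
      (u : ℝ → EuclideanSpace ℝ (Fin 3) → EuclideanSpace ℝ (Fin 3))
      (p : ℝ → EuclideanSpace ℝ (Fin 3) → ℝ),
      IsSuitableWeakSolutionOn O 1 0 u p → ∀ (z : ℝ × EuclideanSpace ℝ (Fin 3)) (r : ℝ), 0 < r →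
        closure (parabolicCylinder r z) ⊆ (O : Set (ℝ × EuclideanSpace ℝ (Fin 3))) →
        ∀ ε₀ : ℝ, 0 < ε₀ → ε₀ ≤ ε₁ → cknC r z u + cknD r z p ≤ ENNReal.ofReal ε₀ →
        ∀ᵐ w ∂(volume.restrict (parabolicCylinder (r / 2) z)),
          ‖u w.1 w.2‖ ≤ cM * ε₀ ^ (1 / 3 : ℝ) / r := by
  -- adapted from `RRS2016.theorem15_3.unforced_oneScale` (RusinSverakSingularityStabilityEpsilon.lean)
  obtain ⟨ε₁, cM, hε₁, hcM, H⟩ := RRS2016.theorem15_3_holds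
  refine ⟨ε₁, cM, hε₁, hcM, fun O u p hsws z r hr hcl ε₀ hε₀ hε₀₁ hsmall => ?_⟩
  obtain ⟨G, hS⟩ := hsws.isLRSuitableWeakSolutionOn_parabolicCylinder hr hcl 3
  have hβ0 : (0 : ℝ) < r ^ 2 := by positivity
  -- the rescaled datum on `Φ⁻¹(Q_r(z)) = Q_1(0, 0)`
  have hS' := hS.nsRescale hr z.1 z.2
  have hf0 : ((r ^ 2 * r) • stPull (r ^ 2) r z.1 z.2
      (0 : ℝ → EuclideanSpace ℝ (Fin 3) → EuclideanSpace ℝ (Fin 3))) = 0 := by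
    funext s y
    rw [smul_stPull_apply, Pi.zero_apply, Pi.zero_apply, smul_zero, Pi.zero_apply, Pi.zero_apply]
  rw [hf0] at hS'
  set Φ := stAffine (r ^ 2) r z.1 z.2 with hΦ
  have hpre : ∀ ρ : ℝ, Φ ⁻¹' parabolicCylinder ρ z =
      parabolicCylinder (ρ / r) (0 : ℝ × EuclideanSpace ℝ (Fin 3)) :=
    fun ρ => stAffine_sq_preimage_parabolicCylinder hr z ρ
  have hpre1 : Φ ⁻¹' parabolicCylinder r z =
      parabolicCylinder 1 (0 : ℝ × EuclideanSpace ℝ (Fin 3)) := by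
    rw [hpre, div_self hr.ne']
  have hpre2 : Φ ⁻¹' parabolicCylinder (r / 2) z =
      parabolicCylinder (1 / 2) (0 : ℝ × EuclideanSpace ℝ (Fin 3)) := by
    rw [hpre]
    congr 1
    field_simp
  have h1 : parabolicCylinder 1 (0 : ℝ × EuclideanSpace ℝ (Fin 3)) ⊆
      ((stPreimage (r ^ 2) r z.1 z.2 (parabolicCylinderOpens r z) :
        Opens (ℝ × EuclideanSpace ℝ (Fin 3))) : Set (ℝ × EuclideanSpace ℝ (Fin 3))) := by
    rw [coe_stPreimage, coe_parabolicCylinderOpens, ← hΦ, hpre1]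
  -- the suitable pair on the unit cylinder
  have hP := hS'.isSuitablePair (by norm_num : (1 : ℝ) ≤ 3) (fun φ _ => by simp) h1
  -- the smallness hypothesis (15.18) of the rescaled pair is `C(r; z) + D(r; z) ≤ ε₀`
  have hpm : AEMeasurable (fun w : ℝ × EuclideanSpace ℝ (Fin 3) => ‖p w.1 w.2‖ₑ ^ (3 / 2 : ℝ))
      (volume.restrict (parabolicCylinder r z)) :=
    (hS.distributional.2.2.1.aestronglyMeasurable).aemeasurable.enorm.pow_const _
  have h0 : ENNReal.ofReal r ^ 2 ≠ 0 := pow_ne_zero _ (ENNReal.ofReal_pos.2 hr).ne'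
  have ht : ENNReal.ofReal r ^ 2 ≠ ⊤ := ENNReal.pow_ne_top ENNReal.ofReal_ne_top
  have hJ : ENNReal.ofReal (r ^ 2 * r ^ Module.finrank ℝ (EuclideanSpace ℝ (Fin 3)))⁻¹ =
      ENNReal.ofReal (r ^ 5)⁻¹ := by
    rw [finrank_euclideanSpace_three]
    congr 1
    ring
  have hsmall' : RRS2016.Small ε₀ (r • stPull (r ^ 2) r z.1 z.2 u)
      (r ^ 2 • stPull (r ^ 2) r z.1 z.2 p) (0 : ℝ × EuclideanSpace ℝ (Fin 3)) := by
    set Fs : ℝ × EuclideanSpace ℝ (Fin 3) → ℝ≥0∞ := fun w =>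
      ‖u w.1 w.2‖ₑ ^ (3 : ℕ) + ‖p w.1 w.2‖ₑ ^ (3 / 2 : ℝ) with hFs
    have hpt : ∀ w : ℝ × EuclideanSpace ℝ (Fin 3),
        ‖(r • stPull (r ^ 2) r z.1 z.2 u) w.1 w.2‖ₑ ^ (3 : ℕ) +
          ‖(r ^ 2 • stPull (r ^ 2) r z.1 z.2 p) w.1 w.2‖ₑ ^ (3 / 2 : ℝ) =
        ENNReal.ofReal (r ^ 3) * Fs (Φ w) := by
      intro w
      rw [smul_stPull_apply, smul_stPull_apply, enorm_smul, enorm_smul, mul_pow,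
        ENNReal.mul_rpow_of_nonneg _ _ (by norm_num), Real.enorm_eq_ofReal hr.le,
        Real.enorm_eq_ofReal hβ0.le, ← ENNReal.ofReal_pow hr.le,
        ENNReal.ofReal_rpow_of_nonneg hβ0.le (by norm_num), sq_rpow_threeHalves hr.le,
        hFs, mul_add]
      rfl
    have hFint : ∫⁻ w in parabolicCylinder r z, Fs w =
        ENNReal.ofReal r ^ 2 * (cknC r z u + cknD r z p) := by
      rw [hFs, lintegral_add_right' _ hpm, mul_add, cknC, cknD, ← mul_assoc, ← mul_assoc,
        ENNReal.mul_inv_cancel h0 ht, one_mul, one_mul]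
    unfold RRS2016.Small
    simp_rw [hpt]
    rw [lintegral_const_mul' _ _ ENNReal.ofReal_ne_top, ← hpre1,
      setLIntegral_preimage_comp_stAffine hβ0 hr z.1 z.2 Fs, hJ, hFint]
    calc ENNReal.ofReal (r ^ 3) * (ENNReal.ofReal (r ^ 5)⁻¹ *
          (ENNReal.ofReal r ^ 2 * (cknC r z u + cknD r z p)))
        ≤ ENNReal.ofReal (r ^ 3) * (ENNReal.ofReal (r ^ 5)⁻¹ *
          (ENNReal.ofReal r ^ 2 * ENNReal.ofReal ε₀)) := by gcongr
      _ = ENNReal.ofReal ε₀ := by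
          rw [← ENNReal.ofReal_pow hr.le, ← ENNReal.ofReal_mul (by positivity),
            ← ENNReal.ofReal_mul (by positivity), ← ENNReal.ofReal_mul (by positivity)]
          congr 1
          field_simp
  -- Thm. 15.3 for the rescaled pair at level `ε₀`, transported back along `Φ`
  have key := H 0 _ _ _ hP ε₀ hε₀ hε₀₁ hsmall'
  rw [← hpre2] at key
  have key' := ae_restrict_of_ae_restrict_preimage_stAffine hβ0 hr z.1 z.2
    (S := parabolicCylinder (r / 2) z) (P := fun w => ‖r • u w.1 w.2‖ ≤ cM * ε₀ ^ (1 / 3 : ℝ)) key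
  filter_upwards [key'] with w hw
  rw [norm_smul, Real.norm_eq_abs, abs_of_pos hr] at hw
  rw [le_div_iff₀ hr, mul_comm]
  exact hw

/-- **Uniform regularity of the approximants near a regular point of the limit** (quantitative
Rusin–Šverák 2011, Lemma 2.1 = Jia–Šverák 2013, Lemma 6; registered stub `stub_uniformRegularity`
of the line `Sketch` of the crux `MinimalDatumPFold`). In the situation of Rusin–Šverák's
Prop. 2.2 on an open set `O` (`RusinSverak2011.CompactnessSituation O useq pseq u p`), if `z₀ ∈ O`
is a regular point of the limit `u`, then there are `ρ > 0` and `B` with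
`‖u^k‖_{L^∞(Q*_ρ(z₀))} ≤ B` for all sufficiently large `k`. Proof: module docstring — the proof
of `rusin_sverak_stability_of_singularities_of_unforced` with the one-scale criterion in the
quantitative form `uniformRegularity_oneScale_quantitative` and the event `∀ᶠ k` kept.
[cite: RusinSverak2011, Lemma 2.1 and its proof (arXiv:0911.0500 p. 4); RobinsonRodrigoSadowski2016 Thm. 15.3 p. 220] -/
theorem stub_uniformRegularity :
    ∀ (O : TopologicalSpace.Opens (ℝ × EuclideanSpace ℝ (Fin 3))) (useq : ℕ → ℝ → EuclideanSpace ℝ (Fin 3) → EuclideanSpace ℝ (Fin 3)) (pseq : ℕ → ℝ → EuclideanSpace ℝ (Fin 3) → ℝ) (u : ℝ → EuclideanSpace ℝ (Fin 3) → EuclideanSpace ℝ (Fin 3)) (p : ℝ → EuclideanSpace ℝ (Fin 3) → ℝ), Literature.Analysis.FluidPDE.RusinSverak2011.CompactnessSituation O useq pseq u p → ∀ z₀ : ℝ × EuclideanSpace ℝ (Fin 3), z₀ ∈ O → Literature.Analysis.FluidPDE.IsRegularPoint u z₀ → ∃ ρ : ℝ, 0 < ρ ∧ ∃ B : NNReal,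 ∀ᶠ k : ℕ in Filter.atTop, MeasureTheory.eLpNorm (Function.uncurry (useq k)) ⊤ (MeasureTheory.volume.restrict (Literature.Analysis.FluidPDE.parabolicCylinderCentered ρ z₀)) ≤ (B : ENNReal) := by
  -- adapted from `rusin_sverak_stability_of_singularities_of_unforced` (RusinSverakSingularityStability.lean)
  intro O useq pseq u p hsit z₀ hz₀ hreg
  obtain ⟨ρ₀, hρ₀, hbdd⟩ := hreg
  obtain ⟨c, hPD⟩ := seregin_sverak_pressure_decay_holds.ratio
  obtain ⟨ε₁, cM, hε₁, hcM, hOS⟩ := uniformRegularity_oneScale_quantitative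
  obtain ⟨θ, hθ, hθhalf, hcθ⟩ := exists_ratio_mul_le_half c
  have hθ1 : θ ≤ 1 := hθhalf.trans (by norm_num)
  -- the essential bound of the limit near `z₀`
  set M : ℝ≥0∞ := eLpNorm (uncurry u) ∞ (volume.restrict (parabolicCylinderCentered ρ₀ z₀))
    with hMdef
  have hM : ∀ᵐ w ∂(volume.restrict (parabolicCylinderCentered ρ₀ z₀)), ‖u w.1 w.2‖ₑ ≤ M :=
    ae_enorm_le_eLpNorm_top u _
  have hMtop : M ≠ ∞ := hbdd.ne
  -- a closed box `K` around `z₀` inside `O`, of size `r₁ ≤ ρ₀/2`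
  obtain ⟨r₂, hr₂, -, hKO₂⟩ := exists_closedCylinder_subset O.isOpen hz₀
  set r₁ : ℝ := min r₂ (ρ₀ / 2) with hr₁def
  have hr₁ : 0 < r₁ := lt_min hr₂ (by positivity)
  have hr₁ρ : r₁ ≤ ρ₀ / 2 := min_le_right _ _
  set K : Set (ℝ × EuclideanSpace ℝ (Fin 3)) :=
    Icc (z₀.1 - r₁ ^ 2) (z₀.1 + r₁ ^ 2) ×ˢ closedBall z₀.2 r₁ with hKdef
  have hKO : K ⊆ (O : Set (ℝ × EuclideanSpace ℝ (Fin 3))) := by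
    have : r₁ ^ 2 ≤ r₂ ^ 2 := pow_le_pow_left₀ hr₁.le (min_le_left _ _) 2
    exact Subset.trans (prod_mono (Icc_subset_Icc (by linarith) (by linarith))
      (closedBall_subset_closedBall (min_le_left _ _))) hKO₂
  have hKc : IsCompact K := isCompact_Icc.prod (isCompact_closedBall _ _)
  -- uniform data of the situation of Prop. 2.2 on `K`
  obtain ⟨Cp, hCp⟩ := hsit.pressure_bound K hKO hKc
  have hT := hsit.tendsto_lintegral K hKO hKc
  -- cylinders `Q_r(t₀ + h, x₀)` with `0 ≤ h ≤ r₁²`, `0 < r ≤ r₁` lie in the box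
  have hbox : ∀ h r, 0 ≤ h → h ≤ r₁ ^ 2 → 0 < r → r ≤ r₁ →
      closure (parabolicCylinder r (z₀.1 + h, z₀.2)) ⊆ K :=
    fun h r h0 hh hr hrr => closure_parabolicCylinder_shift_subset_box h0 hh hr hrr z₀
  -- constants
  set V₁ : ℝ≥0∞ := volume (ball (0 : EuclideanSpace ℝ (Fin 3)) 1) with hV₁
  have hV₁top : V₁ ≠ ∞ := measure_ball_lt_top.ne
  set Θ : ℝ≥0∞ := ENNReal.ofReal ((θ⁻¹) ^ 2) with hΘ
  set L : ℝ≥0∞ := 1 + 2 * ((c : ℝ≥0∞) * Θ) with hL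
  have hLtop : L ≠ ∞ := ENNReal.add_ne_top.2 ⟨ENNReal.one_ne_top,
    ENNReal.mul_ne_top ENNReal.ofNat_ne_top
      (ENNReal.mul_ne_top ENNReal.coe_ne_top ENNReal.ofReal_ne_top)⟩
  set ε : ℝ≥0∞ := ENNReal.ofReal ε₁ with hεdef
  have hε4 : 0 < ε / 4 := ENNReal.div_pos (ENNReal.ofReal_pos.2 hε₁).ne' ENNReal.ofNat_ne_top
  -- (A) the radius `r₀ ≤ r₁`: `L · 4 |B₁| M³ r₀³ ≤ ε/4`
  obtain ⟨rA, hrA, hA⟩ := exists_forall_ofReal_pow_three_mul_le (N := L * (4 * (V₁ * M ^ 3)))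
    (ENNReal.mul_ne_top hLtop (ENNReal.mul_ne_top ENNReal.ofNat_ne_top
      (ENNReal.mul_ne_top hV₁top (ENNReal.pow_ne_top hMtop)))) hε4
  set r₀ : ℝ := min r₁ rA with hr₀def
  have hr₀ : 0 < r₀ := lt_min hr₁ hrA
  have hr₀r₁ : r₀ ≤ r₁ := min_le_left _ _
  have hr₀ρ : r₀ ≤ ρ₀ := by linarith
  have hAr₀ : ENNReal.ofReal (r₀ ^ 3) * (L * (4 * (V₁ * M ^ 3))) ≤ ε / 4 :=
    hA r₀ hr₀ (min_le_right _ _)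
  -- (B) the number of steps `J`
  set P : ℝ≥0∞ := (ENNReal.ofReal r₀ ^ 2)⁻¹ * Cp with hPdef
  have hPtop : P ≠ ∞ :=
    ENNReal.mul_ne_top (ENNReal.inv_ne_top.2 (pow_ne_zero 2 (ENNReal.ofReal_pos.2 hr₀).ne'))
      ENNReal.coe_ne_top
  obtain ⟨J, hJ⟩ := exists_inv_two_pow_mul_le hPtop hε4
  -- the final scale `s = θᴶ r₀`, the shift `h = s²/8`, the centre `z'`
  set s : ℝ := θ ^ J * r₀ with hsdef
  have hs : 0 < s := by positivity
  have hsr₀ : s ≤ r₀ := mul_le_of_le_one_left hr₀.le (pow_le_one₀ hθ.le hθ1)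
  have hscale0 : ∀ j : ℕ, 0 < θ ^ j * r₀ := fun j => by positivity
  have hscale1 : ∀ j : ℕ, θ ^ j * r₀ ≤ r₀ := fun j =>
    mul_le_of_le_one_left hr₀.le (pow_le_one₀ hθ.le hθ1)
  have hscale2 : ∀ j ≤ J, s ≤ θ ^ j * r₀ := fun j hj =>
    mul_le_mul_of_nonneg_right (pow_le_pow_of_le_one hθ.le hθ1 hj) hr₀.le
  set h : ℝ := s ^ 2 / 8 with hhdef
  have hh0 : 0 < h := by positivity
  have hhs' : ∀ j ≤ J, h ≤ (θ ^ j * r₀) ^ 2 := fun j hj => by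
    have : s ^ 2 ≤ (θ ^ j * r₀) ^ 2 := pow_le_pow_left₀ hs.le (hscale2 j hj) 2
    rw [hhdef]; nlinarith
  have hhr₁ : h ≤ r₁ ^ 2 := by
    have : s ^ 2 ≤ r₁ ^ 2 := pow_le_pow_left₀ hs.le (hsr₀.trans hr₀r₁) 2
    rw [hhdef]; nlinarith
  set z' : ℝ × EuclideanSpace ℝ (Fin 3) := (z₀.1 + h, z₀.2) with hz'
  have hclK : ∀ r, 0 < r → r ≤ r₀ → closure (parabolicCylinder r z') ⊆ K :=
    fun r hr hrr => hbox h r hh0.le hhr₁ hr (hrr.trans hr₀r₁)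
  have hclO : ∀ r, 0 < r → r ≤ r₀ →
      closure (parabolicCylinder r z') ⊆ (O : Set (ℝ × EuclideanSpace ℝ (Fin 3))) :=
    fun r hr hrr => (hclK r hr hrr).trans hKO
  -- the event in `k`: strong `L³` convergence on `K`
  have hevT : ∀ᶠ k : ℕ in atTop, L * (4 * ((ENNReal.ofReal s ^ 2)⁻¹ *
      ∫⁻ w in K, ‖useq k w.1 w.2 - u w.1 w.2‖ₑ ^ (3 : ℕ))) ≤ ε / 4 := by
    have hfin : L * (4 * (ENNReal.ofReal s ^ 2)⁻¹) ≠ ∞ :=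
      ENNReal.mul_ne_top hLtop (ENNReal.mul_ne_top ENNReal.ofNat_ne_top
        (ENNReal.inv_ne_top.2 (pow_ne_zero 2 (ENNReal.ofReal_pos.2 hs).ne')))
    have h1 := ENNReal.Tendsto.const_mul hT (Or.inr hfin)
    rw [mul_zero] at h1
    have h2 : Tendsto (fun k : ℕ => L * (4 * ((ENNReal.ofReal s ^ 2)⁻¹ *
        ∫⁻ w in K, ‖useq k w.1 w.2 - u w.1 w.2‖ₑ ^ (3 : ℕ)))) atTop (𝓝 0) := by
      refine h1.congr fun k => ?_
      simp only [mul_assoc]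
    exact h2.eventually (ge_mem_nhds hε4)
  -- the fixed sub-cylinder `Q*_{√h}(z₀) ⊆ Q_{s/2}(z')` and the bound `B = c_M ε₁^{1/3} / s`
  set ρ : ℝ := Real.sqrt h with hρdef
  have hρ : 0 < ρ := Real.sqrt_pos.2 hh0
  have hρ2 : ρ ^ 2 = h := Real.sq_sqrt hh0.le
  have hsub : parabolicCylinderCentered ρ z₀ ⊆ parabolicCylinder (s / 2) z' := by
    refine parabolicCylinderCentered_subset_shift ?_ hρ2.le ?_ z₀
    · have h1 : h ≤ (s / 2) ^ 2 := by rw [hhdef]; nlinarith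
      calc ρ = Real.sqrt h := hρdef
        _ ≤ Real.sqrt ((s / 2) ^ 2) := Real.sqrt_le_sqrt h1
        _ = s / 2 := Real.sqrt_sq (by linarith)
    · rw [hρ2, hhdef]; nlinarith
  refine ⟨ρ, hρ, ⟨cM * ε₁ ^ (1 / 3 : ℝ) / s, by positivity⟩, ?_⟩
  filter_upwards [hevT] with k hkT
  -- the cubic inputs of the approximant `u^k`
  set T : ℝ≥0∞ := ∫⁻ w in K, ‖useq k w.1 w.2 - u w.1 w.2‖ₑ ^ (3 : ℕ) with hTdef
  set e : ℝ≥0∞ := 4 * (V₁ * M ^ 3 * ENNReal.ofReal (r₀ ^ 3)) + 4 * ((ENNReal.ofReal s ^ 2)⁻¹ * T)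
    with hedef
  have hCe : ∀ j ≤ J, cknC (θ ^ j * r₀) z' (useq k) ≤ e := by
    intro j hj
    have hQS : parabolicCylinder (θ ^ j * r₀) z' ⊆ parabolicCylinderCentered ρ₀ z₀ :=
      parabolicCylinder_shift_subset_centered_of_le hh0.le (hhs' j hj) (hscale0 j).le
        ((hscale1 j).trans hr₀ρ) z₀
    have hQK : parabolicCylinder (θ ^ j * r₀) z' ⊆ K :=
      subset_closure.trans (hclK _ (hscale0 j) (hscale1 j))
    refine (cknC_le_of_ae_bound_of_lintegral_sub (hscale0 j) hQS hQK hM le_rfl).trans ?_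
    have h1 : ENNReal.ofReal ((θ ^ j * r₀) ^ 3) ≤ ENNReal.ofReal (r₀ ^ 3) :=
      ENNReal.ofReal_le_ofReal (pow_le_pow_left₀ (hscale0 j).le (hscale1 j) 3)
    have h2 : (ENNReal.ofReal (θ ^ j * r₀) ^ 2)⁻¹ ≤ (ENNReal.ofReal s ^ 2)⁻¹ :=
      ENNReal.inv_le_inv.2 (pow_le_pow_left' (ENNReal.ofReal_le_ofReal (hscale2 j hj)) 2)
    exact add_le_add (mul_le_mul_right (mul_le_mul_right h1 (V₁ * M ^ 3)) 4)
      (mul_le_mul_right (mul_le_mul_left h2 T) 4)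
  -- the pressure of the approximant at the last scale
  have hD : cknD s z' (pseq k) ≤
      (2⁻¹ : ℝ≥0∞) ^ J * cknD r₀ z' (pseq k) + 2 * ((c : ℝ≥0∞) * Θ * e) :=
    cknD_iterate_le_of_pressure_decay hPD hθ hθ1 hcθ (hsit.suitable k).distributional hr₀
      (subset_closure.trans (hclO r₀ hr₀ le_rfl)) (fun j hj => hCe j hj.le)
  have hD0 : cknD r₀ z' (pseq k) ≤ P :=
    (cknD_le_of_subset (pseq k) (subset_closure.trans (hclK r₀ hr₀ le_rfl))).trans
      (mul_le_mul_right (hCp k) _)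
  -- smallness and the quantitative one-scale criterion for `(u^k, p^k)`
  have hsmall : cknC s z' (useq k) + cknD s z' (pseq k) ≤ ε := by
    have h1 : cknC s z' (useq k) ≤ e := hCe J le_rfl
    have h2 : L * e ≤ ε / 4 + ε / 4 := by
      rw [hedef, mul_add]
      refine add_le_add ?_ hkT
      calc L * (4 * (V₁ * M ^ 3 * ENNReal.ofReal (r₀ ^ 3)))
          = ENNReal.ofReal (r₀ ^ 3) * (L * (4 * (V₁ * M ^ 3))) := by ring
        _ ≤ ε / 4 := hAr₀
    have h3 : (2⁻¹ : ℝ≥0∞) ^ J * cknD r₀ z' (pseq k) ≤ ε / 4 := le_trans (by gcongr) hJ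
    calc cknC s z' (useq k) + cknD s z' (pseq k)
        ≤ e + ((2⁻¹ : ℝ≥0∞) ^ J * cknD r₀ z' (pseq k) + 2 * ((c : ℝ≥0∞) * Θ * e)) :=
          add_le_add h1 hD
      _ = L * e + (2⁻¹ : ℝ≥0∞) ^ J * cknD r₀ z' (pseq k) := by rw [hL]; ring
      _ ≤ (ε / 4 + ε / 4) + ε / 4 := add_le_add h2 h3
      _ ≤ ε := ENNReal.add_quarters_le ε
  have hbk := hOS O (useq k) (pseq k) (hsit.suitable k) z' s hs (hclO s hs hsr₀) ε₁ hε₁ le_rfl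
    hsmall
  -- the bound on the fixed sub-cylinder `Q*_ρ(z₀) ⊆ Q_{s/2}(z')`
  rw [eLpNorm_exponent_top]
  refine (eLpNormEssSup_le_of_ae_bound (C := cM * ε₁ ^ (1 / 3 : ℝ) / s) ?_).trans
    (ENNReal.ofReal_eq_coe_nnreal _).le
  filter_upwards [ae_restrict_of_ae_restrict_of_subset hsub hbk] with w hw
  exact hw

end Summit.NavierStokesRegularity.NavierStokesRegularity.Theorems

end
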